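import Summits.QuantumFields.YangMills.Theorems.UnitScaleTiltFluctuationComparisonRegPrPolymerBudget
import Summits.QuantumFields.YangMills.Theorems.UnitScaleTiltFluctuationComparisonRegPrSocketPolymers
import Literature.MathematicalPhysics.QuantumFieldTheory.Balaban1983to89.T3AlphaInputsACSchemas
import Literature.MathematicalPhysics.QuantumFieldTheory.Balaban1983to89.T3Thresholds
import HarnessLib

/-!
# Route `UnitScaleTilt` — crux K1bR-pr `FluctuationComparisonRegPr` (stmt-QuantumFields-19201), S-E″ bookkeeping, part 5: S-E″ FROM THE FOLDED TWO-RUN BUNDLE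
# `TwoRunMin` — pure counting, no guard, no threshold, no minimiser schema on the consumer side
# (support file `--supports stmt-QuantumFields-19201`)

Fleet lead `ym-ust-19201-p2` (gen 2, socket pen); FINDING-19201-e1-scaling (evidence on the item).  The route-level minimiser closeness
`T3AlphaInputsACTwoRun.MinimiserCauchyAt` (e1, v5c/v5d `stub_minimiserCauchy`) is typed as a GLOBAL gauge-orbit sup-distance at the CURVATURE scale
`θ(n)L^{−2k}·L^{−a₁k}`; print's two-cut-off rate for interpolation/minimiser operators is a relative `L^{−γk}` at the FIELD level ([King1986] Prop. 3.8 (3.71)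
p.664), one factor `Lᵏ` above — undischargeable as typed.  The S-E″ bookkeeping needs only the per-polymer comparison of the two runs' terms AT THEIR OWN
trivial-history minimisers with the King-faithful rate: the folded schema `T3AlphaInputsACTwoRunLevel.PolymerCauchyMinAt` (§3 of that module), bundled with the
trivial-history size row on the datum window `TermSizeTriv`, `LocCover`, `LocBlockVolume`, `LocMatched` as `TwoRunMin D b₀ p₀ a`.  From it S-E″ is PURE COUNTING:
`polymerCauchyAt_of_twoRunMin` (budgets `C⁺e^{−κ₁𝓛}Θ²L^{−4(k−i)}(L^{−i})^{b}`, `b = min(a,1)`, extra slice by `TermSizeTriv`, summability by part 2's majorant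
`M(K+1)rᴷ`, `r = L^{−(b−(3+b)/m)}`, for EVERY `K` — no `K₀`), `cauchyAtHeights_of_twoRunMin` (∘ p458947 ∘ p456396), and `levelCauchyOfTwoRunMin_lv` in the registered
quantifier shape (the PROPOSED v5f text of the S-E″ slot, now a theorem: `∀ a > 0, ∃ ε₁ … ∀ D C68, package → TwoRunMin D b₀ p₀ a → CauchyAtHeights D b₀ p₀ m`).
WHAT THIS IS NOT: no estimate of Bałaban's or King's is asserted; every analytic input is a hypothesis schema delivered with the constructed datum.

References: C. King, CMP 102 (1986) 649–677 [King1986] (Thm 3.4 (3.9) p.656, (3.12)–(3.13) p.657, Props. 3.8–3.9 pp.664–665, p.675); T. Bałaban, CMP 102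
(1985) 255–275 [Balaban1985UV3] ((43)–(46) pp.266–267).
-/

noncomputable section

open MeasureTheory Filter Topology
open Literature.MathematicalPhysics.QuantumFieldTheory.Balaban1983to89
open Literature.MathematicalPhysics.QuantumFieldTheory.Balaban1983to89.T3ContinuumYM3Torus
open Literature.MathematicalPhysics.QuantumFieldTheory.Balaban1983to89.T3LevelShift
open Literature.MathematicalPhysics.QuantumFieldTheory.Balaban1983to89.T3UnitLawDensityEML (ℰp measurableE_ℰp)
open Literature.MathematicalPhysics.QuantumFieldTheory.Balaban1983to89.T3UnitScaleTilt
open Literature.MathematicalPhysics.QuantumFieldTheory.Balaban1983to89.T3TiltDescent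
open Literature.MathematicalPhysics.QuantumFieldTheory.Balaban1983to89.T3PrintedRegularMinimiser
open Literature.MathematicalPhysics.QuantumFieldTheory.Balaban1983to89.T3LogComparisonSocket
open Literature.MathematicalPhysics.QuantumFieldTheory.Balaban1983to89.T3AlphaInputsAC
open Literature.MathematicalPhysics.QuantumFieldTheory.Balaban1983to89.T3AlphaPolymerSocket
open Literature.MathematicalPhysics.QuantumFieldTheory.Balaban1983to89.T3AlphaInputsACTwoRunLevel
open Literature.MathematicalPhysics.QuantumFieldTheory.Balaban1983to89.Missing
open Summit.QuantumFields.YangMills.Theorems.LogComparisonPolymerBudget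

namespace Summit.QuantumFields.YangMills.Theorems.LogComparisonLevelCauchyMin

variable {F : T3Family} {γ : ℝ} (D : AlphaDataT3 F γ)

/-! ## §1 `PolymerCauchyAt` from the folded bundle -/

/-- **THE POLYMER SOCKET FROM THE FOLDED BUNDLE** (S-E″, pure counting): for `1 < L`, `0 < γ ≤ 1`, `0 < b₀`, `0 < p₀`, `0 < a` and `m > (3+b)/b`, `b = min(a,1)`,
`TwoRunMin D b₀ p₀ a` gives `PolymerCauchyAt D b₀ p₀ m` — per-polymer budgets `η K j Y = C⁺e^{−κ₁𝓛(Y)}Θ²L^{−4(K−⌊K/m⌋−1−j)}(L^{−(1+j)})^{b}` (the folded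
comparison with `θ(n) ≤ Θ`, `(L^{−i})^{a} ≤ (L^{−i})^{b}`), shifts `c K ⌊K/m⌋ j Y`, extra slice `δ₀ K = Σ_{Y} C⁺e^{−κ₁𝓛}Θ²L^{−4k}` from `TermSizeTriv` at run `K+1`,
`c₀ = 0`; summability by `matched_budget_le`/`extra_budget_le`/`rpow_free_fraction_le`/`summable_majorant` (p476005), for every `K`.
[cite: King1986, Thm 3.4 (3.9) p.656 and (3.12)-(3.13) p.657] -/
theorem polymerCauchyAt_of_twoRunMin {b₀ p₀ a : ℝ} {m : ℕ}
    (hL : 1 < F.L) (hγ : 0 < γ) (hγ1 : γ ≤ 1) (hb : 0 < b₀) (hp : 0 < p₀) (ha : 0 < a)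
    (hm : (3 + min a 1) / min a 1 < (m : ℝ)) (hTR : TwoRunMin D b₀ p₀ a) :
    PolymerCauchyAt D b₀ p₀ m := by
  classical
  obtain ⟨κ₁, ⟨Cts, hTS⟩, ⟨C', hLC⟩, hBV, hLM, ⟨Cp, c, hMin⟩⟩ := hTR
  -- the exponent b and the free fraction m
  set b : ℝ := min a 1 with hbdef
  have hb0 : 0 < b := lt_min ha one_pos
  have hb1 : b ≤ 1 := min_le_right _ _
  have hba : b ≤ a := min_le_left _ _
  have hm0r : (0 : ℝ) < m := lt_trans (by positivity) hm
  have hm0 : 0 < m := by exact_mod_cast hm0r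
  have hc0 : 0 < b - (3 + b) / m := by
    have : (3 + b) / (m : ℝ) < b := by
      rw [div_lt_iff₀ hm0r]
      have := (div_lt_iff₀ hb0).mp hm
      linarith
    linarith
  have hLr : (1 : ℝ) < (F.L : ℝ) := by exact_mod_cast hL
  have hL0 : (0 : ℝ) < (F.L : ℝ) := by linarith
  obtain ⟨hr0, hr1⟩ := rpow_neg_lt_one hLr hc0
  -- the uniform bound Θ of the thresholds
  obtain ⟨Θ, hΘdef⟩ : ∃ Θ : ℝ, Θ = b₀ * ((2 * p₀) ^ p₀ * Real.exp (1 / 2 - p₀)) * Real.sqrt (Real.sqrt γ) := ⟨_, rfl⟩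
  have hθΘ : ∀ i, θBal F.L γ b₀ p₀ i ≤ Θ := fun i => by
    rw [hΘdef]; exact T3Thresholds.θBal_le_const_mul_rpow hL.le hγ hγ1 hb.le hp i
  have hθ0 : ∀ i, 0 < θBal F.L γ b₀ p₀ i := T3MinimiserStabilityReduction.θBal_pos hL.le hγ hγ1 hb p₀
  have hΘ0 : 0 ≤ Θ := (hθ0 0).le.trans (hθΘ 0)
  obtain ⟨M₀, hM₀def⟩ : ∃ M₀ : ℝ, M₀ = max Cp 0 * Θ ^ 2 := ⟨_, rfl⟩
  have hM₀ : 0 ≤ M₀ := by rw [hM₀def]; positivity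
  -- the budgets (opaque names with defining equations)
  obtain ⟨η, hη⟩ : ∃ η : (K j : ℕ) → Set (Site (F.P K) 0) → ℝ, ∀ K j Y, η K j Y =
      M₀ * Real.exp (-κ₁ * D.treeLen K (1 + j) Y) * (((F.L : ℝ) ^ (K - K / m - 1 - j))⁻¹) ^ 4 * (((F.L : ℝ) ^ (1 + j))⁻¹) ^ b :=
    ⟨_, fun _ _ _ => rfl⟩
  obtain ⟨δ₀, hδ₀⟩ : ∃ δ₀ : ℕ → ℝ, ∀ K, δ₀ K = ∑ Y ∈ D.Loc (K + 1) (K + 1 - K / m) (D.triv (K + 1) (K + 1 - K / m)) 1,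
      max Cts 0 * Real.exp (-κ₁ * D.treeLen (K + 1) 1 Y) * Θ ^ 2 * (((F.L : ℝ) ^ (K - K / m))⁻¹) ^ 4 :=
    ⟨_, fun _ => rfl⟩
  have hη0 : ∀ K j Y, 0 ≤ η K j Y := fun K j Y => by rw [hη]; positivity
  have hδ₀0 : ∀ K, 0 ≤ δ₀ K := fun K => by rw [hδ₀]; exact Finset.sum_nonneg fun Y _ => by positivity
  refine ⟨η, fun K j Y => c K (K / m) j Y, δ₀, fun _ => 0, hη0, hδ₀0, ?_, fun K => ?_, fun K j hj Y hY => ?_⟩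
  · -- summability: the majorant `Mtot·(K+1)·r^K` dominates for every K
    have hA : 0 ≤ 8 * max Cts 0 * max C' 0 * Θ ^ 2 * (F.L : ℝ) ^ (3 * F.m) := by positivity
    have hB : 0 ≤ 8 * M₀ * max C' 0 * (F.L : ℝ) ^ (3 * F.m) := by positivity
    have hbound : ∀ K,
        δ₀ K + ∑ j ∈ Finset.range (K - K / m), ∑ Y ∈ D.Loc K (K - K / m) (D.triv K (K - K / m)) (1 + j), η K j Y ≤
          (8 * max Cts 0 * max C' 0 * Θ ^ 2 * (F.L : ℝ) ^ (3 * F.m) + 8 * M₀ * max C' 0 * (F.L : ℝ) ^ (3 * F.m)) * ((K : ℝ) + 1) *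
            ((F.L : ℝ) ^ (-(b - (3 + b) / m))) ^ K := by
      intro K
      have hsum : ∑ j ∈ Finset.range (K - K / m), ∑ Y ∈ D.Loc K (K - K / m) (D.triv K (K - K / m)) (1 + j), η K j Y =
          ∑ j ∈ Finset.range (K - K / m), ∑ Y ∈ D.Loc K (K - K / m) (D.triv K (K - K / m)) (1 + j),
            M₀ * Real.exp (-κ₁ * D.treeLen K (1 + j) Y) * (((F.L : ℝ) ^ (K - K / m - 1 - j))⁻¹) ^ 4 * (((F.L : ℝ) ^ (1 + j))⁻¹) ^ b :=
        Finset.sum_congr rfl fun j _ => Finset.sum_congr rfl fun Y _ => by rw [hη]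
      rw [hsum, hδ₀]
      have hn : K / m ≤ K := Nat.div_le_self K m
      have hex := extra_budget_le D hLC hBV (C := max Cts 0) (Θ := Θ) (le_max_right _ _) hb1 hn (D.triv (K + 1) (K + 1 - K / m))
      have hma := matched_budget_le D hLC hBV hM₀ hb1 hn (D.triv K (K - K / m))
      have hdec := rpow_free_fraction_le hLr hb0.le hm0 K
      have hkK : ((K - K / m : ℕ) : ℝ) ≤ (K : ℝ) + 1 := by
        have : ((K - K / m : ℕ) : ℝ) ≤ K := by exact_mod_cast Nat.sub_le K (K / m)
        linarith
      have hK1 : (1 : ℝ) ≤ (K : ℝ) + 1 := by have : (0 : ℝ) ≤ K := Nat.cast_nonneg K; linarith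
      have he0 : 0 ≤ (F.L : ℝ) ^ ((3 * (K / m : ℕ) - b * (K - K / m : ℕ) : ℝ)) := Real.rpow_nonneg hL0.le _
      refine (add_le_add hex hma).trans ?_
      have hAe : 8 * max Cts 0 * max C' 0 * Θ ^ 2 * (F.L : ℝ) ^ (3 * F.m) * (F.L : ℝ) ^ ((3 * (K / m : ℕ) - b * (K - K / m : ℕ) : ℝ)) ≤
          ((K : ℝ) + 1) * (8 * max Cts 0 * max C' 0 * Θ ^ 2 * (F.L : ℝ) ^ (3 * F.m) * ((F.L : ℝ) ^ (-(b - (3 + b) / m))) ^ K) := by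
        have h1 : 8 * max Cts 0 * max C' 0 * Θ ^ 2 * (F.L : ℝ) ^ (3 * F.m) * (F.L : ℝ) ^ ((3 * (K / m : ℕ) - b * (K - K / m : ℕ) : ℝ)) ≤
            8 * max Cts 0 * max C' 0 * Θ ^ 2 * (F.L : ℝ) ^ (3 * F.m) * ((F.L : ℝ) ^ (-(b - (3 + b) / m))) ^ K :=
          mul_le_mul_of_nonneg_left hdec hA
        exact h1.trans (le_mul_of_one_le_left (mul_nonneg hA (pow_nonneg hr0.le K)) hK1)
      have hBe : ((K - K / m : ℕ) : ℝ) * (8 * M₀ * max C' 0 * (F.L : ℝ) ^ (3 * F.m) * (F.L : ℝ) ^ ((3 * (K / m : ℕ) - b * (K - K / m : ℕ) : ℝ))) ≤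
          ((K : ℝ) + 1) * (8 * M₀ * max C' 0 * (F.L : ℝ) ^ (3 * F.m) * ((F.L : ℝ) ^ (-(b - (3 + b) / m))) ^ K) :=
        mul_le_mul hkK (mul_le_mul_of_nonneg_left hdec hB) (mul_nonneg hB he0) (by linarith)
      refine (add_le_add hAe hBe).trans (le_of_eq ?_)
      ring
    have hnn : ∀ K, 0 ≤ δ₀ K + ∑ j ∈ Finset.range (K - K / m), ∑ Y ∈ D.Loc K (K - K / m) (D.triv K (K - K / m)) (1 + j), η K j Y :=
      fun K => add_nonneg (hδ₀0 K) (Finset.sum_nonneg fun j _ => Finset.sum_nonneg fun Y _ => hη0 K j Y)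
    exact Summable.of_nonneg_of_le hnn hbound (summable_majorant _ hr0.le hr1)
  · -- the extra finest slice of run K+1: `TermSizeTriv` alone
    refine ae_of_all _ fun V hV _ _ => ?_
    rw [sub_zero, hδ₀]
    have hn : K / m ≤ K := Nat.div_le_self K m
    have hn' : K / m ≤ K + 1 := hn.trans (Nat.le_succ K)
    refine (Finset.abs_sum_le_sum_abs _ _).trans (Finset.sum_le_sum fun Y hY => ?_)
    have h1 := hTS.2 (K + 1) (K / m) hn' V hV 1 le_rfl (by omega) Y hY
    refine h1.trans ?_
    have hKK : K + 1 - K / m - 1 = K - K / m := by omega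
    rw [hKK]
    have hθ2 : θBal F.L γ b₀ p₀ (K / m + 1) ^ 2 ≤ Θ ^ 2 := pow_le_pow_left₀ (hθ0 _).le (hθΘ _) 2
    have hX : 0 ≤ Real.exp (-κ₁ * D.treeLen (K + 1) 1 Y) * (((F.L : ℝ) ^ (K - K / m))⁻¹) ^ 4 := by positivity
    calc Cts * Real.exp (-κ₁ * D.treeLen (K + 1) 1 Y) * θBal F.L γ b₀ p₀ (K / m + 1) ^ 2 * (((F.L : ℝ) ^ (K - K / m))⁻¹) ^ 4
        = Cts * θBal F.L γ b₀ p₀ (K / m + 1) ^ 2 * (Real.exp (-κ₁ * D.treeLen (K + 1) 1 Y) * (((F.L : ℝ) ^ (K - K / m))⁻¹) ^ 4) := by ring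
      _ ≤ max Cts 0 * Θ ^ 2 * (Real.exp (-κ₁ * D.treeLen (K + 1) 1 Y) * (((F.L : ℝ) ^ (K - K / m))⁻¹) ^ 4) := by
          refine mul_le_mul_of_nonneg_right ?_ hX
          calc Cts * θBal F.L γ b₀ p₀ (K / m + 1) ^ 2 ≤ max Cts 0 * θBal F.L γ b₀ p₀ (K / m + 1) ^ 2 :=
                mul_le_mul_of_nonneg_right (le_max_left _ _) (by positivity)
            _ ≤ max Cts 0 * Θ ^ 2 := mul_le_mul_of_nonneg_left hθ2 (le_max_right _ _)
      _ = max Cts 0 * Real.exp (-κ₁ * D.treeLen (K + 1) 1 Y) * Θ ^ 2 * (((F.L : ℝ) ^ (K - K / m))⁻¹) ^ 4 := by ring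
  · -- the matched pairs: the folded comparison, uniformised
    refine ae_of_all _ fun V hV _ _ => ?_
    rw [hη, hM₀def]
    have hn : K / m ≤ K := Nat.div_le_self K m
    have hest := hMin K (K / m) hn j hj V hV Y hY
    refine hest.trans ?_
    have hx0 : 0 < ((F.L : ℝ) ^ (1 + j))⁻¹ := by positivity
    have hx1 : ((F.L : ℝ) ^ (1 + j))⁻¹ ≤ 1 := inv_le_one_of_one_le₀ (one_le_pow₀ hLr.le)
    have hxa : (((F.L : ℝ) ^ (1 + j))⁻¹) ^ a ≤ (((F.L : ℝ) ^ (1 + j))⁻¹) ^ b := Real.rpow_le_rpow_of_exponent_ge hx0 hx1 hba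
    have hθ2 : θBal F.L γ b₀ p₀ (K / m) ^ 2 ≤ Θ ^ 2 := pow_le_pow_left₀ (hθ0 _).le (hθΘ _) 2
    have h1 : θBal F.L γ b₀ p₀ (K / m) ^ 2 * (((F.L : ℝ) ^ (1 + j))⁻¹) ^ a ≤ Θ ^ 2 * (((F.L : ℝ) ^ (1 + j))⁻¹) ^ b :=
      mul_le_mul hθ2 hxa (Real.rpow_nonneg hx0.le _) (by positivity)
    have hX : 0 ≤ Real.exp (-κ₁ * D.treeLen K (1 + j) Y) * (((F.L : ℝ) ^ (K - K / m - 1 - j))⁻¹) ^ 4 := by positivity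
    calc Cp * Real.exp (-κ₁ * D.treeLen K (1 + j) Y) * θBal F.L γ b₀ p₀ (K / m) ^ 2 * (((F.L : ℝ) ^ (K - K / m - 1 - j))⁻¹) ^ 4 *
          (((F.L : ℝ) ^ (1 + j))⁻¹) ^ a
        = Cp * ((Real.exp (-κ₁ * D.treeLen K (1 + j) Y) * (((F.L : ℝ) ^ (K - K / m - 1 - j))⁻¹) ^ 4) *
            (θBal F.L γ b₀ p₀ (K / m) ^ 2 * (((F.L : ℝ) ^ (1 + j))⁻¹) ^ a)) := by ring
      _ ≤ max Cp 0 * ((Real.exp (-κ₁ * D.treeLen K (1 + j) Y) * (((F.L : ℝ) ^ (K - K / m - 1 - j))⁻¹) ^ 4) *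
            (θBal F.L γ b₀ p₀ (K / m) ^ 2 * (((F.L : ℝ) ^ (1 + j))⁻¹) ^ a)) :=
          mul_le_mul_of_nonneg_right (le_max_left _ _) (mul_nonneg hX (by positivity))
      _ ≤ max Cp 0 * ((Real.exp (-κ₁ * D.treeLen K (1 + j) Y) * (((F.L : ℝ) ^ (K - K / m - 1 - j))⁻¹) ^ 4) *
            (Θ ^ 2 * (((F.L : ℝ) ^ (1 + j))⁻¹) ^ b)) :=
          mul_le_mul_of_nonneg_left (mul_le_mul_of_nonneg_left h1 hX) (le_max_right _ _)
      _ = max Cp 0 * Θ ^ 2 * Real.exp (-κ₁ * D.treeLen K (1 + j) Y) * (((F.L : ℝ) ^ (K - K / m - 1 - j))⁻¹) ^ 4 *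
            (((F.L : ℝ) ^ (1 + j))⁻¹) ^ b := by ring

/-! ## §2 `CauchyAtHeights` from the folded bundle — clause-level, and in the registered quantifier shape -/

/-- **S-E″ CLOSED FROM THE FOLDED BUNDLE** (pure counting): for `1 < L`, `0 < γ ≤ 1`, `0 < b₀`, `0 < p₀`, `0 < a`, `m > (3+b)/b` (`b = min(a,1)`),
`PintDecomp D` and `TwoRunMin D b₀ p₀ a` give `CauchyAtHeights D b₀ p₀ m` — `polymerCauchyAt_of_twoRunMin`, then `levelCauchyAt_of_polymerwise` (p458947) and
`cauchyAtHeights_of_levelwise` (p456396). [cite: King1986, Thm 3.4 (3.9) p.656] -/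
theorem cauchyAtHeights_of_twoRunMin {b₀ p₀ a : ℝ} {m : ℕ}
    (hL : 1 < F.L) (hγ : 0 < γ) (hγ1 : γ ≤ 1) (hb : 0 < b₀) (hp : 0 < p₀) (ha : 0 < a)
    (hm : (3 + min a 1) / min a 1 < (m : ℝ)) (hdec : PintDecomp D) (hTR : TwoRunMin D b₀ p₀ a) :
    CauchyAtHeights D b₀ p₀ m := by
  have hLM : LocMatched D := by
    obtain ⟨κ₁, -, -, -, hLM, -⟩ := hTR
    exact hLM
  exact LogComparisonSocketLevelsAlpha.cauchyAtHeights_of_levelwise D hdec b₀ p₀ m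
    (LogComparisonSocketPolymers.levelCauchyAt_of_polymerwise D b₀ p₀ m hLM
      (polymerCauchyAt_of_twoRunMin D hL hγ hγ1 hb hp ha hm hTR))

/-- **THE PROPOSED v5f TEXT OF THE S-E″ SLOT** (a THEOREM, no longer a stub; registered-shape quantifier prefix kept so that the skeleton's §2 composes it like
the other stubs): for every exponent `a > 0`, with `ε₁ = 1`, `m₀ = ⌈(3+b)/b⌉ + 1` (`b = min(a,1)`), `γ₁ = 1`: the package (for `PintDecomp`) and the folded bundle
`TwoRunMin D b₀ p₀ a` of a datum give `CauchyAtHeights D b₀ p₀ m`.  No e1 stub, no `C68`/`ε₀` dependence. [cite: King1986, Thm 3.4 (3.9) p.656] -/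
theorem levelCauchyOfTwoRunMin_lv :
    ∀ (L : ℕ), Odd L → 1 < L → ∀ (a : ℝ), 0 < a →
      ∃ ε₁ : ℝ, 0 < ε₁ ∧ ∀ (ε₀ : ℝ), 0 < ε₀ → ε₀ ≤ ε₁ → ∃ m₀ : ℕ, ∀ (m : ℕ), m₀ ≤ m → ∀ (b₀ p₀ : ℝ), 0 < b₀ → 2 < p₀ →
        ∃ γ₁ : ℝ, 0 < γ₁ ∧ ∀ (F : T3Family) (γ : ℝ), F.L = L → 0 < γ → γ ≤ γ₁ →
          ∀ (D : AlphaDataT3 F γ) (C68 : ℝ),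
            Literature.MathematicalPhysics.QuantumFieldTheory.Balaban1983to89.T3AlphaInputsACSchemas.AlphaInputsT3AC D b₀ p₀ ε₀ C68 →
              TwoRunMin D b₀ p₀ a → CauchyAtHeights D b₀ p₀ m := by
  intro L _ hL a ha
  refine ⟨1, one_pos, fun ε₀ _ _ => ?_⟩
  refine ⟨Nat.ceil ((3 + min a 1) / min a 1) + 1, fun m hm b₀ p₀ hb hp => ?_⟩
  refine ⟨1, one_pos, fun F γ hF hγ hγ1 D C68 hPkg hTR => ?_⟩
  have hm' : (3 + min a 1) / min a 1 < (m : ℝ) := by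
    have h1 := Nat.le_ceil ((3 + min a 1) / min a 1)
    have h2 : ((Nat.ceil ((3 + min a 1) / min a 1) + 1 : ℕ) : ℝ) ≤ m := by exact_mod_cast hm
    push_cast at h2
    linarith
  have hL' : 1 < F.L := by rw [hF]; exact hL
  exact cauchyAtHeights_of_twoRunMin D hL' hγ hγ1 hb (by linarith) ha hm' hPkg.1.1 hTR

/-- **THE PROPOSED v5g TEXT OF THE S-E″ SLOT — PACKAGE-FREE** (registered-shape quantifier prefix; hypotheses = exactly what §2 of the skeleton consumes from the
α-adapter stub besides `RepAtHeights`): for every `a > 0` (`ε₁ = γ₁ = 1`, `m₀ = ⌈(3+b)/b⌉ + 1`, `b = min(a,1)`), the (43)-decomposition `PintDecomp D` and the folded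
two-run bundle `TwoRunMin D b₀ p₀ a` give `CauchyAtHeights D b₀ p₀ m`.  With it the 19201 adapter stub can conclude `∃ D, RepAtHeights D b₀ p₀ ε₀ ∧ PintDecomp D ∧
TwoRunMin D b₀ p₀ a` — no package, no `C68`: crux 19201 decoupled from the per-run package's errata (v1.1 → v1.3 → …). [cite: King1986, Thm 3.4 (3.9) p.656] -/
theorem levelCauchyOfTwoRunMin_dec :
    ∀ (L : ℕ), Odd L → 1 < L → ∀ (a : ℝ), 0 < a →
      ∃ ε₁ : ℝ, 0 < ε₁ ∧ ∀ (ε₀ : ℝ), 0 < ε₀ → ε₀ ≤ ε₁ → ∃ m₀ : ℕ, ∀ (m : ℕ), m₀ ≤ m → ∀ (b₀ p₀ : ℝ), 0 < b₀ → 2 < p₀ →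
        ∃ γ₁ : ℝ, 0 < γ₁ ∧ ∀ (F : T3Family) (γ : ℝ), F.L = L → 0 < γ → γ ≤ γ₁ →
          ∀ (D : AlphaDataT3 F γ), PintDecomp D → TwoRunMin D b₀ p₀ a → CauchyAtHeights D b₀ p₀ m := by
  intro L _ hL a ha
  refine ⟨1, one_pos, fun ε₀ _ _ => ?_⟩
  refine ⟨Nat.ceil ((3 + min a 1) / min a 1) + 1, fun m hm b₀ p₀ hb hp => ?_⟩
  refine ⟨1, one_pos, fun F γ hF hγ hγ1 D hdec hTR => ?_⟩
  have hm' : (3 + min a 1) / min a 1 < (m : ℝ) := by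
    have h1 := Nat.le_ceil ((3 + min a 1) / min a 1)
    have h2 : ((Nat.ceil ((3 + min a 1) / min a 1) + 1 : ℕ) : ℝ) ≤ m := by exact_mod_cast hm
    push_cast at h2
    linarith
  have hL' : 1 < F.L := by rw [hF]; exact hL
  exact cauchyAtHeights_of_twoRunMin D hL' hγ hγ1 hb (by linarith) ha hm' hdec hTR

end Summit.QuantumFields.YangMills.Theorems.LogComparisonLevelCauchyMin

end
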